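import Mathlib
import Summits.MatrixMultiplication.MatrixMultiplication.Theses.FidelityWitnesses
import Literature.Computability.AlgebraicComplexity.AlderStrassen
import Summits.MatrixMultiplication.MatrixMultiplication.Theorems.FidelityWitnessesSevenEighthsLawStubSliceElimination
import Summits.MatrixMultiplication.MatrixMultiplication.Theorems.FidelityWitnessesSevenEighthsLawStubCapEasyRegime

/-!
# `FidelityWitnesses.SixEighthsAtFive` (stmt-MatrixMultiplication-14040) — reduction to the hard regime

The support item `SixEighthsAtFive` of route `MatrixMultiplication/FidelityWitnesses` is `M(2,5) ≤ 6`: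
`‖Σ S·⟨2,2,2⟩‖² ≤ 6 · Σ‖S‖²` for every tensor `S` of rank `≤ 5` in the `2 × 2` format
(slots `S a b c`, `a = (κ,ν)` output, `b = (κ,μ)`, `c = (μ,ν)`).

EXACT OUTPUT ELIMINATION (the E-picture of the sibling crux `SevenEighthsLaw`, one rung down).  Write
`P2 = Fin 2 × Fin 2`, `m(f) : a ↦ Σ_μ f (a.1,μ) (μ,a.2)` for `f : P2 → P2 → ℂ` (the matrix product `U V`
when `f = U ⊗ V`; `m m* = 2`), and for an orthonormal `k`-frame `e` (`⟨f,g⟩ = Σ conj f · g`)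
`cap e := Σ_s ‖m(e_s)‖²` (`= 2 tr(P_E Π_W)`, `E = span e`, `W = m*(ℂ^{P2})` the span of the four output
slices of `⟨2,2,2⟩`).  A rank-`≤ 5` tensor is a sum of five triads; its five products `u_l ⊗ v_l` lie in an
honest product-spanned `5`-plane with orthonormal basis `e` (`sixEighthsAtFive_productFrame`, this file);
the output slices of `S` lie in `span e`, so the tree's slice elimination
(`SevenEighthsLaw.stub_sliceElimination`) gives `|⟨S,T⟩|² ≤ ‖S‖² · cap e`.  Hence

  `SixEighthsAtFive ⟸ (cap e ≤ 6 for every orthonormal 5-frame e inside an honest product 5-plane)`.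

The capture bound splits by `d := dim span{m(e_s)} = 5 − dim (E ∩ ker m)`:
* EASY regime `d ≤ 3` (i.e. `dim (E ∩ ker m) ≥ 2`): `cap e ≤ 2 d ≤ 6` — the tree's
  `SevenEighthsLaw.stub_capEasyRegime` verbatim (Bessel; no products needed).  Bini's border plane
  `span{T_(1,1), T_(1,2), e₂₁⊗e₁₁, e₂₁⊗e₁₂, e₁₂⊗e₁₂}` (limit of scheme (2.1.2) of Landsberg 2017) is NOT
  here: it has `d = 4` and `cap = 6` exactly.
* HARD regime `d = 4` (`E ∩ ker m = ℂ z`, `E ⊖ z = graph L`, `L : W → ker m`): the claim is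
  `cap e ≤ 6`, i.e. `Σ_{i ≤ 4} s_i(L)²/(1 + s_i(L)²) ≥ 1` — THE load-bearing inequality, taken as the
  hypothesis `hhard` of `sixEighthsAtFive_of_capHardRegime` below (kernel-checked composition).

So the item is EQUIVALENT (given the tree) to one finite-dimensional inequality on honest product
5-planes in the hard regime; this file lands the glue.
-/

set_option linter.dupNamespace false

namespace Summit.MatrixMultiplication.MatrixMultiplication.Theorems

open scoped BigOperators ComplexConjugate InnerProductSpace
open Literature.Computability.AlgebraicComplexity InnerProductSpace

/-! ## Product frames for five products (adapted from `SevenEighthsLaw.stub_productFrame`, `6 ↦ 5`) -/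

/-- Exchange/padding lemma: if the family `w` spans the space, then any index set `A` with at
most `n ≤ finrank` elements is captured by the span of `w` on some `n`-element index set `C` on
which `w` is linearly independent. [folklore] -/
private theorem sixEighthsAtFive_exists_linearIndepOn_ncard_eq {K E ι : Type*} [Field K]
    [AddCommGroup E] [Module K E] [Finite ι] (w : ι → E) (A : Set ι) (n : ℕ)
    (hA : A.ncard ≤ n) (hn : n ≤ Module.finrank K E)
    (hw : ⊤ ≤ Submodule.span K (Set.range w)) :
    ∃ C : Set ι, C.ncard = n ∧ LinearIndepOn K w C ∧ w '' A ⊆ Submodule.span K (w '' C) := by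
  obtain ⟨s₀, hs₀A, -, hAs₀, hs₀li⟩ :=
    exists_linearIndepOn_extension (linearIndepOn_empty K w) (Set.empty_subset A)
  obtain ⟨B, -, hs₀B, hB, hBli⟩ := exists_linearIndepOn_extension hs₀li (Set.subset_univ s₀)
  have hs₀n : s₀.ncard ≤ n := (Set.ncard_le_ncard hs₀A).trans hA
  have hBspan : ⊤ ≤ Submodule.span K (Set.range fun x : B => w x) := by
    rw [← Set.image_eq_range]
    refine hw.trans (Submodule.span_le.mpr ?_)
    rw [← Set.image_univ]
    exact hB
  have hcard : Module.finrank K E = B.ncard := by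
    rw [Module.finrank_eq_nat_card_basis (Module.Basis.mk hBli.linearIndependent hBspan),
      Nat.card_coe_set_eq]
  obtain ⟨C, hs₀C, hCB, hC⟩ := Set.exists_subsuperset_card_eq hs₀B hs₀n (hcard ▸ hn)
  exact ⟨C, hC, hBli.mono hCB, hAs₀.trans (Submodule.span_mono (Set.image_mono hs₀C))⟩

/-- **Product frame for five products.** For any five products `u l ⊗ v l` in
`(Fin 2 × Fin 2) → (Fin 2 × Fin 2) → ℂ` there are five products `u' l ⊗ v' l` and an orthonormal
(for `⟨f, g⟩ = Σ_b Σ_c conj (f b c) * g b c`) `5`-frame `e` with every `e s` in the span of the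
`u' l ⊗ v' l` and every `u l ⊗ v l` in the span of `e` (pad a maximal independent subfamily by
standard products, Gram–Schmidt in `EuclideanSpace ℂ (P2 × P2)`).  This is where the rank bound
`5` of the item is consumed. [folklore] -/
theorem sixEighthsAtFive_productFrame (u v : Fin 5 → (Fin 2 × Fin 2) → ℂ) :
    ∃ (u' v' : Fin 5 → (Fin 2 × Fin 2) → ℂ) (e : Fin 5 → (Fin 2 × Fin 2) → (Fin 2 × Fin 2) → ℂ),
      (∀ s t : Fin 5, (∑ b, ∑ c, conj (e s b c) * e t b c) = if s = t then 1 else 0) ∧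
      (∀ s, e s ∈ Submodule.span ℂ (Set.range fun l : Fin 5 => fun b c => u' l b * v' l c)) ∧
      ∀ l : Fin 5, (fun b c => u l b * v l c) ∈ Submodule.span ℂ (Set.range e) := by
  classical
  -- factor families indexed by `Fin 5 ⊕ (P2 × P2)`: the five given products, then the standard ones
  let X : Fin 5 ⊕ (Fin 2 × Fin 2) × (Fin 2 × Fin 2) → (Fin 2 × Fin 2) → ℂ :=
    Sum.elim u fun bc b => if b = bc.1 then 1 else 0
  let Y : Fin 5 ⊕ (Fin 2 × Fin 2) × (Fin 2 × Fin 2) → (Fin 2 × Fin 2) → ℂ :=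
    Sum.elim v fun bc c => if c = bc.2 then 1 else 0
  -- the products, as vectors of the Euclidean space on `P2 × P2`
  let w : Fin 5 ⊕ (Fin 2 × Fin 2) × (Fin 2 × Fin 2) →
      EuclideanSpace ℂ ((Fin 2 × Fin 2) × (Fin 2 × Fin 2)) :=
    fun i => WithLp.toLp 2 fun bc => X i bc.1 * Y i bc.2
  -- back to curried functions (a linear map)
  let ψ : EuclideanSpace ℂ ((Fin 2 × Fin 2) × (Fin 2 × Fin 2)) →ₗ[ℂ]
      (Fin 2 × Fin 2) → (Fin 2 × Fin 2) → ℂ :=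
    { toFun := fun x b c => x (b, c)
      map_add' := fun _ _ => rfl
      map_smul' := fun _ _ => rfl }
  -- the standard products are the standard basis vectors
  have hstd : ∀ bc, w (Sum.inr bc) = EuclideanSpace.single bc 1 := by
    rintro ⟨b, c⟩
    ext ⟨b', c'⟩
    simp only [w, X, Y, Sum.elim_inr, PiLp.single_apply, Prod.mk.injEq]
    by_cases h1 : b' = b <;> by_cases h2 : c' = c <;> simp [h1, h2]
  have hw : ⊤ ≤ Submodule.span ℂ (Set.range w) := by
    rw [← (PiLp.basisFun 2 ℂ ((Fin 2 × Fin 2) × (Fin 2 × Fin 2))).span_eq]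
    refine Submodule.span_mono ?_
    rintro _ ⟨bc, rfl⟩
    exact ⟨Sum.inr bc, by rw [PiLp.basisFun_apply]; exact hstd bc⟩
  have hA : (Set.range (Sum.inl : Fin 5 → Fin 5 ⊕ (Fin 2 × Fin 2) × (Fin 2 × Fin 2))).ncard ≤ 5 := by
    rw [Set.ncard_range_of_injective Sum.inl_injective]
    simp
  have h5 : 5 ≤ Module.finrank ℂ (EuclideanSpace ℂ ((Fin 2 × Fin 2) × (Fin 2 × Fin 2))) := by
    simp
  obtain ⟨C, hC, hCli, hAC⟩ :=
    sixEighthsAtFive_exists_linearIndepOn_ncard_eq w (Set.range Sum.inl) 5 hA h5 hw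
  -- enumerate `C` by `Fin 5`
  have hCcard : Nat.card C = 5 := by rw [Nat.card_coe_set_eq, hC]
  let σ : Fin 5 ≃ C := (Finite.equivFinOfCardEq hCcard).symm
  let p : Fin 5 → EuclideanSpace ℂ ((Fin 2 × Fin 2) × (Fin 2 × Fin 2)) := fun l => w (σ l)
  have hpli : LinearIndependent ℂ p := hCli.linearIndependent.comp σ σ.injective
  have hpC : w '' C ⊆ Set.range p := by
    rintro _ ⟨i, hi, rfl⟩
    exact ⟨σ.symm ⟨i, hi⟩, by simp [p, σ]⟩
  -- Gram–Schmidt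
  have he' : Orthonormal ℂ (gramSchmidtNormed ℂ p) := gramSchmidtNormed_orthonormal hpli
  have hspan : Submodule.span ℂ (Set.range (gramSchmidtNormed ℂ p)) =
      Submodule.span ℂ (Set.range p) := by
    rw [span_gramSchmidtNormed_range, span_gramSchmidt]
  have key : ∀ x y : EuclideanSpace ℂ ((Fin 2 × Fin 2) × (Fin 2 × Fin 2)),
      (∑ b, ∑ c, conj (x (b, c)) * y (b, c)) = inner ℂ x y := by
    intro x y
    simp only [PiLp.inner_apply, RCLike.inner_apply]
    rw [Fintype.sum_prod_type (f := fun bc => y bc * conj (x bc))]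
    exact Finset.sum_congr rfl fun b _ => Finset.sum_congr rfl fun c _ => mul_comm _ _
  refine ⟨fun l => X (σ l), fun l => Y (σ l), fun s b c => gramSchmidtNormed ℂ p s (b, c),
    ?_, ?_, ?_⟩
  · intro s t
    rw [← orthonormal_iff_ite.mp he' s t]
    exact key _ _
  · intro s
    have hs : gramSchmidtNormed ℂ p s ∈ Submodule.span ℂ (Set.range p) := by
      rw [← hspan]
      exact Submodule.subset_span ⟨s, rfl⟩
    have := Submodule.apply_mem_span_image_of_mem_span ψ hs
    rw [← Set.range_comp] at this
    exact this
  · intro l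
    have hl : w (Sum.inl l) ∈ Submodule.span ℂ (Set.range (gramSchmidtNormed ℂ p)) := by
      rw [hspan]
      exact Submodule.span_mono hpC (hAC ⟨Sum.inl l, ⟨l, rfl⟩, rfl⟩)
    have := Submodule.apply_mem_span_image_of_mem_span ψ hl
    rw [← Set.range_comp] at this
    exact this

/-! ## The composition -/

/-- The output slices of a sum of five triads lie in the span of any frame containing the five
products. [folklore] -/
theorem sixEighthsAtFive_slice_mem_span {k : ℕ} (e : Fin k → (Fin 2 × Fin 2) → (Fin 2 × Fin 2) → ℂ)
    (w u v : Fin 5 → (Fin 2 × Fin 2) → ℂ)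
    (hprod : ∀ l : Fin 5, (fun b c => u l b * v l c) ∈ Submodule.span ℂ (Set.range e))
    (a : Fin 2 × Fin 2) :
    (∑ i, triad (w i) (u i) (v i)) a ∈ Submodule.span ℂ (Set.range e) := by
  have hslice : (∑ i, triad (w i) (u i) (v i)) a =
      ∑ i, w i a • (fun b c => u i b * v i c : (Fin 2 × Fin 2) → (Fin 2 × Fin 2) → ℂ) := by
    funext b c
    simp [Finset.sum_apply, triad_apply, Pi.smul_apply, smul_eq_mul, mul_assoc]
  rw [hslice]
  exact Submodule.sum_mem _ fun i _ => Submodule.smul_mem _ _ (hprod i)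

/-- **`SixEighthsAtFive` from the hard-regime capture bound (kernel-checked reduction).**
If every orthonormal `5`-frame `e` lying in an honest product `5`-plane
(`e s ∈ span{u l ⊗ v l : l < 5}`) whose multiplied vectors `m(e_s) : a ↦ Σ_μ e_s (a.1,μ) (μ,a.2)`
span all four dimensions of `ℂ^{P2}` (the HARD regime, `dim (E ∩ ker m) = 1`) has capture
`cap e = Σ_s ‖m(e_s)‖² ≤ 6`, then `M(2,5) ≤ 6`.
Proof: a rank-`≤ 5` tensor `S` is a sum of five triads (`exists_eq_sum_triad_of_tensorRank_le`);
its products sit in a product 5-plane with orthonormal basis `e` (`sixEighthsAtFive_productFrame`);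
`cap e ≤ 6` by the dichotomy — easy regime `dim span m(e) ≤ 3` from the tree's
`SevenEighthsLaw.stub_capEasyRegime`, hard regime by hypothesis; the output slices of `S` lie in
`span e` (`sixEighthsAtFive_slice_mem_span`), and the tree's exact output elimination
`SevenEighthsLaw.stub_sliceElimination` gives `|Σ S·T|² ≤ ‖S‖² · cap e ≤ 6 ‖S‖²`. [folklore] -/
theorem sixEighthsAtFive_of_capHardRegime
    (hhard : ∀ (u v : Fin 5 → (Fin 2 × Fin 2) → ℂ)
      (e : Fin 5 → (Fin 2 × Fin 2) → (Fin 2 × Fin 2) → ℂ),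
      (∀ s t : Fin 5, (∑ b, ∑ c, conj (e s b c) * e t b c) = if s = t then 1 else 0) →
      (∀ s, e s ∈ Submodule.span ℂ (Set.range fun l : Fin 5 => fun b c => u l b * v l c)) →
      3 < Module.finrank ℂ (Submodule.span ℂ (Set.range fun s : Fin 5 =>
        fun a : Fin 2 × Fin 2 => ∑ μ : Fin 2, e s (a.1, μ) (μ, a.2))) →
      ∑ s, ∑ a : Fin 2 × Fin 2, ‖∑ m : Fin 2, e s (a.1, m) (m, a.2)‖ ^ 2 ≤ 6) :
    Summit.MatrixMultiplication.MatrixMultiplication.Theses.FidelityWitnesses.SixEighthsAtFive := by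
  unfold Summit.MatrixMultiplication.MatrixMultiplication.Theses.FidelityWitnesses.SixEighthsAtFive
  intro S hS
  obtain ⟨w, u, v, hdec⟩ := exists_eq_sum_triad_of_tensorRank_le hS
  obtain ⟨u', v', e, he, hps, hprod⟩ := sixEighthsAtFive_productFrame u v
  have hcap : (∑ s, ∑ a : Fin 2 × Fin 2, ‖∑ m : Fin 2, e s (a.1, m) (m, a.2)‖ ^ 2) ≤ 6 := by
    by_cases hdim : Module.finrank ℂ (Submodule.span ℂ (Set.range fun s : Fin 5 =>
        fun a : Fin 2 × Fin 2 => ∑ μ : Fin 2, e s (a.1, μ) (μ, a.2))) ≤ 3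
    · exact SevenEighthsLaw.stub_capEasyRegime e he hdim
    · exact hhard u' v' e he hps (not_le.mp hdim)
  have hslices : ∀ a : Fin 2 × Fin 2, S a ∈ Submodule.span ℂ (Set.range e) := by
    intro a
    rw [hdec]
    exact sixEighthsAtFive_slice_mem_span e w u v hprod a
  have h1 := SevenEighthsLaw.stub_sliceElimination e he S hslices
  have hnn : (0 : ℝ) ≤ ∑ a, ∑ b, ∑ c, ‖S a b c‖ ^ 2 := by positivity
  calc ‖∑ a, ∑ b, ∑ c, S a b c * matMulTensor ℂ 2 2 2 a b c‖ ^ 2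
      ≤ (∑ a, ∑ b, ∑ c, ‖S a b c‖ ^ 2) *
          ∑ s, ∑ a : Fin 2 × Fin 2, ‖∑ m : Fin 2, e s (a.1, m) (m, a.2)‖ ^ 2 := h1
    _ ≤ (∑ a, ∑ b, ∑ c, ‖S a b c‖ ^ 2) * 6 := mul_le_mul_of_nonneg_left hcap hnn
    _ = 6 * ∑ a, ∑ b, ∑ c, ‖S a b c‖ ^ 2 := by ring

end Summit.MatrixMultiplication.MatrixMultiplication.Theorems
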